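import Mathlib

/-!
# Zhang (2022): the terminal block of the cell's constraint file — binding cycles at row level

Trunk T-ANT (NumberTheory/LFunctions). Y. Zhang, *Discrete mean estimates and the Landau–Siegel
zero*, arXiv:2211.02515v1 (2022) [Zhang2022LandauSiegel] — an unrefereed manuscript under
adjudication (cell pub-zhang: audit + repair census; **no claim about Landau–Siegel**). **Nothing in
this file asserts or denies its Theorems 1–2, its Propositions 2.1–2.6, 14.1, or any analytic
lemma.** It is the kernel face of the cell's sweep seat 2 (binding-constraint map), row S2-12 of
`sweep/sweep-2/BINDING-MAP-v7.md` (constraint file `sweep/CONSTRAINTS-v7.json` = v8 = v9 on every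
row used here): the TERMINAL BLOCK of the constraint file is the set of its 19 live rows whose check
constrains one of the four free thresholds of the §2 endgame — `thr24` (the cap `d24` on `|𝔡′+𝔡|`,
Prop. 2.4 / (10.17)), `thr25` (the constant `c25` of Prop. 2.5), `thr232` (the constant `q232` of
(2.32)) and `thr233` (the constant `cJ` of (2.33)) — every other name of a row being fixed at the
file's certified parameter value (exact rationals / the printed decimals; the kernel sources of those
values, all in this namespace, are `dsum_normSq_bounds` (module `Section10Certificate`: 28.0791 <
|𝔡′+𝔡|² < 28.0792 at ι_paper), `C232_bounds` (`Section2MainOrder`) and `not_ineq18sum`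
(`Section18Certificate`) (the (2.32) main order 0.05534… resp. 0.0553459320…), `C232cG_ge`
(`Section18AllIota`: the all-ι floor 0.02491), `C233_bounds` (`Section10Certificate`: 2546.8476 <
C₂.₃₃ < 2546.8478); this file imports none of those modules and re-proves nothing about them: here
the values are literals, exactly as in the constraint file).

What is proved is pure real arithmetic on a four-field parameter record (`Thresholds`), i.e.
CONSISTENCY of rows, never truth of inputs:

* `Row`, `Row.holds`: the 19 rows, each check transcribed literally (row id ↦ constructor in the
  docstrings; JSON `thr24 thr25 thr232 thr233` ↦ `d24 c25 q232 cJ`);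
* `Row.role`: the ten ROLES (what a row contributes to a contradiction): `AL` thr24 ≤ 5 (linear cap,
  `N-II.10.17a`), `AS` thr24² < 28.079… (square cap, `N-P2.4s`, `N-P2.4n`), `P24` thr24 > 0, `T`
  thr25 < thr24, `C` thr232·thr233 < thr25², `S` thr25 > 0 (the sign rows), `Sq` thr232·thr233 < thr24²,
  `L232` a certified lower bound ≥ 0.02491 for thr232, `L232p` the manuscript's own (18.2) value
  0.0008 < thr232, `L233` a certified lower bound ≥ 2546.8476 for thr233;
* `not_feasible_iff_hasPattern`: a set of rows is infeasible over ℝ⁴ iff its set of roles contains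
  one of the FIVE role patterns `E1 = {AL,T,C,S,L232,L233}`, `E2 = {AS,T,C,S,L232,L233}` (mechanism
  M1, the linear chain), `E3 = {AS,Sq,L232,L233}` (M2, square), `E4 = {AL,P24,Sq,L232,L233}` (M3),
  `E5 = {AL,T,S,Sq,L232,L233}` (M3′) — the single inequality behind all of them is `key_product`:
  0.02491 · 2546.8476 = 63.44… > 28.0792 ≥ every cap on a square; the converse is eight explicit
  rational witnesses `W1 … W8`, one per maximal pattern-free role set;
* consequences: every infeasible subsystem contains a certified (2.32)-row AND a (2.33)-row
  (`mem_roles_of_not_feasible`); `III-18.02b` lies in no binding cycle (`not_feasible_erase_iff`);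
  the printed design (5, 2, 0.001, 3000) satisfies exactly the rows of role ≠ `L232`
  (`holds_printed_iff`); without the sign rows and the square row everything else is satisfiable with
  thr25 = −15 (`W2`, the sign is load-bearing in the linear typing);
* `isMinimalIIS_iff`: the MINIMAL infeasible subsystems are exactly the transversals "one row per
  role of a pattern" (`mem_minimalIISs_iff`), and by the product rule (`card_transversals_eq`) their
  number is `card_minimalIISs`: 96 + 192 + 24 + 12 + 48 = **372** (by mechanism 288 / 24 / 12 / 48,
  sizes 4 / 5 / 6 only) — the count the cell's exact-rational enumeration reports (sweep-2 gen 5,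
  `binding_map_v7_out.json`, farm replay job j057717); here it is a kernel theorem.

[cite: Zhang2022LandauSiegel, §2 (2.18)–(2.19), (2.32)–(2.33), Props. 2.4–2.5, §10 (10.17), §18
(18.2)–(18.3)]
-/

noncomputable section

namespace Literature.NumberTheory.LFunctions.Zhang2022

namespace TerminalBlock

/-- The four free thresholds of the §2 endgame: `d24` (JSON `thr24`, the cap of Prop. 2.4 on
`|𝔡′+𝔡|`), `c25` (`thr25`, the constant of Prop. 2.5), `q232` (`thr232`, the constant of (2.32)),
`cJ` (`thr233`, the constant of (2.33)). [cite: Zhang2022LandauSiegel, Props. 2.4–2.5, (2.32)–(2.33)] -/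
structure Thresholds where
  d24 : ℝ
  c25 : ℝ
  q232 : ℝ
  cJ : ℝ

/-- The ten roles of terminal rows (see the module docstring).
[cite: Zhang2022LandauSiegel, §2 (2.18)–(2.19), Props. 2.4–2.5, (2.32)–(2.33)] -/
inductive Role
  | AL | AS | P24 | T | C | S | Sq | L232 | L232p | L233
  deriving DecidableEq, Fintype, Repr

/-- The 19 live rows of the cell constraint file (v7 = v8 = v9) whose check constrains a threshold,
by row id: `I-2.32a`, `I-P2.4a`, `I-P2.5a`, `I-T9a`, `III-18.02b`, `III-18.03f`, `III-2.P25a`,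
`III-2.P25b`, `III-2.asm`, `N-2.32Gs`, `N-2.32s`, `N-2.33n`, `N-2.33s`, `N-II.10.17a`, `N-II.2.33a`,
`N-III.18sum`, `N-P2.4n`, `N-P2.4s`, `N-P2.5s`.
[cite: Zhang2022LandauSiegel, §2, §10 (10.17), §18 (18.2)–(18.3)] -/
inductive Row
  | I_2_32a | I_P2_4a | I_P2_5a | I_T9a | III_18_02b | III_18_03f | III_2_P25a | III_2_P25b
  | III_2_asm | N_2_32Gs | N_2_32s | N_2_33n | N_2_33s | N_II_10_17a | N_II_2_33a | N_III_18sum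
  | N_P2_4n | N_P2_4s | N_P2_5s
  deriving DecidableEq, Fintype, Repr

/-- `r.holds t`: the check of row `r` at thresholds `t`, transcribed literally from the constraint
file with every non-threshold name at its file value:
`I-2.32a` `thr232*thr233 < thr25*thr25` · `I-P2.4a` `thr24 > 0` · `I-P2.5a` `thr25 > 0` ·
`I-T9a` `thr24 > thr25` · `III-18.02b` `th824 + th98 + 2*th182 < thr232` (6.9955, 6.9955, −6.9951) ·
`III-18.03f` `2*4400*100000 < thr233*314159` · `III-2.P25a` `thr232*thr233 < thr25**2` ·
`III-2.P25b` `thr25 > 0 and thr232 >= 0 and thr233 >= 0` · `III-2.asm` `thr25 < thr24` ·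
`N-2.32Gs` `Q_c_ge < thr232` (2491/100000) · `N-2.32s` `Q_c_lo < thr232` (2767/50000) ·
`N-2.33n` `C233_lo < thr233` (6367119/2500) · `N-2.33s` `C233_hi < thr233` (12734239/5000) ·
`N-II.10.17a` `dprime_re > crude10 - th10corr and crude10 - th10corr > th10b and abs(dfrak_re) < th10c
and dfrak_re > 0 and dsum_abs > thr24 and th10b - th10c >= thr24` (5.1459074120, 5.1458823, 0.04,
5.1, 0.0129584722, 0.1, 5.2989794526) · `N-II.2.33a` `C233 < thr233` (2546.8477030) ·
`N-III.18sum` `Fraction(553459320, 10**10) < thr232` · `N-P2.4n` `thr24**2 < dsq_hi` (35099/1250) ·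
`N-P2.4s` `dsq_lo > thr24**2` (280791/10000) · `N-P2.5s` `thr24**2 > thr232*thr233`.
[cite: Zhang2022LandauSiegel, §2, §10 (10.17), §18 (18.2)–(18.3)] -/
def Row.holds : Row → Thresholds → Prop
  | .I_2_32a, t => t.q232 * t.cJ < t.c25 * t.c25
  | .I_P2_4a, t => 0 < t.d24
  | .I_P2_5a, t => 0 < t.c25
  | .I_T9a, t => t.c25 < t.d24
  | .III_18_02b, t => (6.9955 : ℝ) + 6.9955 + 2 * (-6.9951) < t.q232
  | .III_18_03f, t => (2 * 4400 * 100000 : ℝ) < t.cJ * 314159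
  | .III_2_P25a, t => t.q232 * t.cJ < t.c25 ^ 2
  | .III_2_P25b, t => 0 < t.c25 ∧ 0 ≤ t.q232 ∧ 0 ≤ t.cJ
  | .III_2_asm, t => t.c25 < t.d24
  | .N_2_32Gs, t => (2491 / 100000 : ℝ) < t.q232
  | .N_2_32s, t => (2767 / 50000 : ℝ) < t.q232
  | .N_2_33n, t => (6367119 / 2500 : ℝ) < t.cJ
  | .N_2_33s, t => (12734239 / 5000 : ℝ) < t.cJ
  | .N_II_10_17a, t => (5.1458823 : ℝ) - 0.04 < 5.1459074120 ∧ (5.1 : ℝ) < 5.1458823 - 0.04 ∧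
      |(0.0129584722 : ℝ)| < 0.1 ∧ (0 : ℝ) < 0.0129584722 ∧ t.d24 < 5.2989794526 ∧ t.d24 ≤ 5.1 - 0.1
  | .N_II_2_33a, t => (2546.8477030 : ℝ) < t.cJ
  | .N_III_18sum, t => (553459320 : ℝ) / 10 ^ 10 < t.q232
  | .N_P2_4n, t => t.d24 ^ 2 < 35099 / 1250
  | .N_P2_4s, t => t.d24 ^ 2 < 280791 / 10000
  | .N_P2_5s, t => t.q232 * t.cJ < t.d24 ^ 2

/-- The role of each row. [cite: Zhang2022LandauSiegel, §2, §10 (10.17), §18 (18.2)–(18.3)] -/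
def Row.role : Row → Role
  | .I_2_32a => .C
  | .I_P2_4a => .P24
  | .I_P2_5a => .S
  | .I_T9a => .T
  | .III_18_02b => .L232p
  | .III_18_03f => .L233
  | .III_2_P25a => .C
  | .III_2_P25b => .S
  | .III_2_asm => .T
  | .N_2_32Gs => .L232
  | .N_2_32s => .L232
  | .N_2_33n => .L233
  | .N_2_33s => .L233
  | .N_II_10_17a => .AL
  | .N_II_2_33a => .L233
  | .N_III_18sum => .L232
  | .N_P2_4n => .AS
  | .N_P2_4s => .AS
  | .N_P2_5s => .Sq

/-- `Sat S t`: every row of `S` holds at `t`. [folklore] -/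
def Sat (S : Finset Row) (t : Thresholds) : Prop := ∀ r ∈ S, r.holds t

/-- `Feasible S`: the rows of `S` are simultaneously satisfiable over ℝ⁴. [folklore] -/
def Feasible (S : Finset Row) : Prop := ∃ t, Sat S t

/-- The set of roles present in `S`. [folklore] -/
def roles (S : Finset Row) : Finset Role := S.image Row.role

/-- A subsystem of a feasible system is feasible. [folklore] -/
theorem feasible_mono {S₁ S₂ : Finset Row} (h : S₁ ⊆ S₂) (hS : Feasible S₂) : Feasible S₁ := by
  obtain ⟨t, ht⟩ := hS
  exact ⟨t, fun r hr => ht r (h hr)⟩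

/-! ## The five role patterns -/

/-- M1 (linear chain, linear cap): thr24 ≤ 5, thr25 < thr24, thr232·thr233 < thr25², thr25 > 0, L232, L233.
[cite: Zhang2022LandauSiegel, §2 (2.18)–(2.19), Props. 2.4–2.5, (2.32)–(2.33)] -/
def E1 : Finset Role := {.AL, .T, .C, .S, .L232, .L233}
/-- M1 (linear chain, square cap): thr24² < 28.079…, thr25 < thr24, thr232·thr233 < thr25², thr25 > 0, L232, L233.
[cite: Zhang2022LandauSiegel, §2 (2.18)–(2.19), Props. 2.4–2.5, (2.32)–(2.33)] -/
def E2 : Finset Role := {.AS, .T, .C, .S, .L232, .L233}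
/-- M2 (square): thr24² < 28.079…, thr232·thr233 < thr24², L232, L233.
[cite: Zhang2022LandauSiegel, §2 (2.18)–(2.19), Props. 2.4–2.5, (2.32)–(2.33)] -/
def E3 : Finset Role := {.AS, .Sq, .L232, .L233}
/-- M3: thr24 ≤ 5, thr24 > 0, thr232·thr233 < thr24², L232, L233.
[cite: Zhang2022LandauSiegel, §2 (2.18)–(2.19), Props. 2.4–2.5, (2.32)–(2.33)] -/
def E4 : Finset Role := {.AL, .P24, .Sq, .L232, .L233}
/-- M3′: thr24 ≤ 5, 0 < thr25 < thr24, thr232·thr233 < thr24², L232, L233.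
[cite: Zhang2022LandauSiegel, §2 (2.18)–(2.19), Props. 2.4–2.5, (2.32)–(2.33)] -/
def E5 : Finset Role := {.AL, .T, .S, .Sq, .L232, .L233}

/-- The list of role patterns.
[cite: Zhang2022LandauSiegel, §2 (2.18)–(2.19), Props. 2.4–2.5, (2.32)–(2.33)] -/
def patterns : List (Finset Role) := [E1, E2, E3, E4, E5]

/-- `HasPattern ρ`: the role set `ρ` contains one of the five patterns.
[cite: Zhang2022LandauSiegel, §2 (2.18)–(2.19), Props. 2.4–2.5, (2.32)–(2.33)] -/
def HasPattern (ρ : Finset Role) : Prop := ∃ e ∈ patterns, e ⊆ ρ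

/-- `HasPattern` is decidable (a finite list of finite subset tests). [folklore] -/
instance : DecidablePred HasPattern := fun ρ => by
  unfold HasPattern; infer_instance

/-- `HasPattern` is monotone in the role set. [folklore] -/
theorem hasPattern_mono {ρ₁ ρ₂ : Finset Role} (h : ρ₁ ⊆ ρ₂) (h₁ : HasPattern ρ₁) : HasPattern ρ₂ := by
  obtain ⟨e, he, he'⟩ := h₁
  exact ⟨e, he, he'.trans h⟩

/-- `HasPattern` spelled out as memberships, one disjunct per pattern E1–E5. [folklore] -/
theorem hasPattern_iff (ρ : Finset Role) : HasPattern ρ ↔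
    (Role.AL ∈ ρ ∧ Role.T ∈ ρ ∧ Role.C ∈ ρ ∧ Role.S ∈ ρ ∧ Role.L232 ∈ ρ ∧ Role.L233 ∈ ρ) ∨
    (Role.AS ∈ ρ ∧ Role.T ∈ ρ ∧ Role.C ∈ ρ ∧ Role.S ∈ ρ ∧ Role.L232 ∈ ρ ∧ Role.L233 ∈ ρ) ∨
    (Role.AS ∈ ρ ∧ Role.Sq ∈ ρ ∧ Role.L232 ∈ ρ ∧ Role.L233 ∈ ρ) ∨
    (Role.AL ∈ ρ ∧ Role.P24 ∈ ρ ∧ Role.Sq ∈ ρ ∧ Role.L232 ∈ ρ ∧ Role.L233 ∈ ρ) ∨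
    (Role.AL ∈ ρ ∧ Role.T ∈ ρ ∧ Role.S ∈ ρ ∧ Role.Sq ∈ ρ ∧ Role.L232 ∈ ρ ∧ Role.L233 ∈ ρ) := by
  simp [HasPattern, patterns, E1, E2, E3, E4, E5, Finset.insert_subset_iff]

/-! ## The one inequality -/

/-- 0.02491 · 2546.8476 = 63.4419… > 28.0792: the product of the weakest certified lower bounds for
thr232 and thr233 exceeds every cap on a square (28.0792 ≥ 28.0791 ≥ 25).
[cite: Zhang2022LandauSiegel, §2 (2.18)–(2.19), Props. 2.4–2.5, (2.32)–(2.33)] -/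
theorem key_product {q J : ℝ} (hq : 2491 / 100000 < q) (hJ : 6367119 / 2500 < J) :
    35099 / 1250 < q * J := by
  have h := mul_lt_mul'' hq hJ (by norm_num) (by norm_num)
  norm_num at h
  linarith

/-- The linear cap thr24 ≤ 5 with thr24 > 0 implies the square cap.
[cite: Zhang2022LandauSiegel, §2 (2.18)–(2.19), Props. 2.4–2.5, (2.32)–(2.33)] -/
theorem sq_cap_of_le_five {d : ℝ} (hd5 : d ≤ 5) (hd : 0 < d) : d ^ 2 < 35099 / 1250 := by
  nlinarith

/-- The common core of all four mechanisms: a capped square above the product is impossible.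
[cite: Zhang2022LandauSiegel, §2 (2.18)–(2.19), Props. 2.4–2.5, (2.32)–(2.33)] -/
theorem core {d q J : ℝ} (hcap : d ^ 2 < 35099 / 1250) (hprod : q * J < d ^ 2)
    (hq : 2491 / 100000 < q) (hJ : 6367119 / 2500 < J) : False := by
  have := key_product hq hJ
  linarith

/-! ## What each role gives -/

section consequences

variable {S : Finset Row} {t : Thresholds}

/-- Role `AL` (`N-II.10.17a`, last conjunct `th10b - th10c >= thr24`): thr24 ≤ 5. [cite:
Zhang2022LandauSiegel, §2, §10 (10.17), §18 (18.2)–(18.3)] -/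
theorem le_five_of_AL (ht : Sat S t) (h : Role.AL ∈ roles S) : t.d24 ≤ 5 := by
  obtain ⟨r, hr, hρ⟩ := Finset.mem_image.mp h
  have hh := ht r hr
  cases r <;> simp [Row.role] at hρ
  simp only [Row.holds] at hh
  obtain ⟨-, -, -, -, -, h6⟩ := hh
  norm_num at h6
  exact h6

/-- Role `AS` (`N-P2.4s` 28.0791, `N-P2.4n` 28.0792): thr24² < 28.0792. [cite:
Zhang2022LandauSiegel, §2, §10 (10.17), §18 (18.2)–(18.3)] -/
theorem sq_cap_of_AS (ht : Sat S t) (h : Role.AS ∈ roles S) : t.d24 ^ 2 < 35099 / 1250 := by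
  obtain ⟨r, hr, hρ⟩ := Finset.mem_image.mp h
  have hh := ht r hr
  cases r <;> simp [Row.role] at hρ <;> simp only [Row.holds] at hh <;> linarith

/-- Role `P24` (`I-P2.4a`): 0 < thr24. [cite: Zhang2022LandauSiegel, §2, §10 (10.17), §18
(18.2)–(18.3)] -/
theorem pos_of_P24 (ht : Sat S t) (h : Role.P24 ∈ roles S) : 0 < t.d24 := by
  obtain ⟨r, hr, hρ⟩ := Finset.mem_image.mp h
  have hh := ht r hr
  cases r <;> simp [Row.role] at hρ
  simpa [Row.holds] using hh

/-- Role `T` (`I-T9a`, `III-2.asm`): thr25 < thr24. [cite: Zhang2022LandauSiegel, §2, §10 (10.17),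
§18 (18.2)–(18.3)] -/
theorem lt_of_T (ht : Sat S t) (h : Role.T ∈ roles S) : t.c25 < t.d24 := by
  obtain ⟨r, hr, hρ⟩ := Finset.mem_image.mp h
  have hh := ht r hr
  cases r <;> simp [Row.role] at hρ <;> simpa [Row.holds] using hh

/-- Role `C` (`I-2.32a`, `III-2.P25a`): thr232·thr233 < thr25². [cite: Zhang2022LandauSiegel, §2,
§10 (10.17), §18 (18.2)–(18.3)] -/
theorem prod_lt_of_C (ht : Sat S t) (h : Role.C ∈ roles S) : t.q232 * t.cJ < t.c25 ^ 2 := by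
  obtain ⟨r, hr, hρ⟩ := Finset.mem_image.mp h
  have hh := ht r hr
  cases r <;> simp [Row.role] at hρ <;> simp only [Row.holds] at hh <;> nlinarith

/-- Role `S` (`I-P2.5a`, `III-2.P25b`): 0 < thr25. [cite: Zhang2022LandauSiegel, §2, §10 (10.17),
§18 (18.2)–(18.3)] -/
theorem pos_of_S (ht : Sat S t) (h : Role.S ∈ roles S) : 0 < t.c25 := by
  obtain ⟨r, hr, hρ⟩ := Finset.mem_image.mp h
  have hh := ht r hr
  cases r <;> simp [Row.role] at hρ <;> simp only [Row.holds] at hh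
  · exact hh
  · exact hh.1

/-- Role `Sq` (`N-P2.5s`): thr232·thr233 < thr24². [cite: Zhang2022LandauSiegel, §2, §10 (10.17),
§18 (18.2)–(18.3)] -/
theorem prod_lt_of_Sq (ht : Sat S t) (h : Role.Sq ∈ roles S) : t.q232 * t.cJ < t.d24 ^ 2 := by
  obtain ⟨r, hr, hρ⟩ := Finset.mem_image.mp h
  have hh := ht r hr
  cases r <;> simp [Row.role] at hρ
  simpa [Row.holds] using hh

/-- Role `L232` (`N-2.32Gs` 0.02491, `N-2.32s` 0.05534, `N-III.18sum` 0.055345932): the weakest,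
2491/100000 < thr232. [cite: Zhang2022LandauSiegel, §2, §10 (10.17), §18 (18.2)–(18.3)] -/
theorem q_of_L232 (ht : Sat S t) (h : Role.L232 ∈ roles S) : 2491 / 100000 < t.q232 := by
  obtain ⟨r, hr, hρ⟩ := Finset.mem_image.mp h
  have hh := ht r hr
  cases r <;> simp [Row.role] at hρ <;> simp only [Row.holds] at hh <;> norm_num at hh ⊢ <;> linarith

/-- Role `L233` (`N-2.33n` 2546.8476, `N-2.33s` 2546.8478, `N-II.2.33a` 2546.847703, `III-18.03f`
8800·10⁵/314159 ≈ 2801.13): the weakest, 6367119/2500 < thr233. [cite: Zhang2022LandauSiegel, §2,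
§10 (10.17), §18 (18.2)–(18.3)] -/
theorem J_of_L233 (ht : Sat S t) (h : Role.L233 ∈ roles S) : 6367119 / 2500 < t.cJ := by
  obtain ⟨r, hr, hρ⟩ := Finset.mem_image.mp h
  have hh := ht r hr
  cases r <;> simp [Row.role] at hρ <;> simp only [Row.holds] at hh <;> norm_num at hh ⊢ <;> linarith

end consequences

/-! ## Patterns are infeasible -/

/-- Each of the five role patterns is infeasible: mechanisms M1 (linear / square cap), M2, M3, M3′,
all through `core`. [cite: Zhang2022LandauSiegel, §2 (2.18)–(2.19), Props. 2.4–2.5, (2.32)–(2.33)]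
-/
theorem not_feasible_of_hasPattern {S : Finset Row} (h : HasPattern (roles S)) : ¬ Feasible S := by
  rintro ⟨t, ht⟩
  rw [hasPattern_iff] at h
  rcases h with ⟨hAL, hT, hC, hS, h232, h233⟩ | ⟨hAS, hT, hC, hS, h232, h233⟩ |
    ⟨hAS, hSq, h232, h233⟩ | ⟨hAL, hP24, hSq, h232, h233⟩ | ⟨hAL, hT, hS, hSq, h232, h233⟩
  · -- M1, linear cap: 0 < c25 < d24 ≤ 5
    exact core (sq_cap_of_le_five ((lt_of_T ht hT).le.trans (le_five_of_AL ht hAL)) (pos_of_S ht hS))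
      (prod_lt_of_C ht hC) (q_of_L232 ht h232) (J_of_L233 ht h233)
  · -- M1, square cap: c25² < d24² < 28.0792
    have hc : 0 < t.c25 := pos_of_S ht hS
    have hcd : t.c25 < t.d24 := lt_of_T ht hT
    have hsq : t.c25 ^ 2 < t.d24 ^ 2 := by nlinarith
    exact core (sq_cap_of_AS ht hAS) ((prod_lt_of_C ht hC).trans hsq) (q_of_L232 ht h232)
      (J_of_L233 ht h233)
  · -- M2
    exact core (sq_cap_of_AS ht hAS) (prod_lt_of_Sq ht hSq) (q_of_L232 ht h232) (J_of_L233 ht h233)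
  · -- M3
    exact core (sq_cap_of_le_five (le_five_of_AL ht hAL) (pos_of_P24 ht hP24)) (prod_lt_of_Sq ht hSq)
      (q_of_L232 ht h232) (J_of_L233 ht h233)
  · -- M3′
    exact core (sq_cap_of_le_five (le_five_of_AL ht hAL) ((pos_of_S ht hS).trans (lt_of_T ht hT)))
      (prod_lt_of_Sq ht hSq) (q_of_L232 ht h232) (J_of_L233 ht h233)

/-! ## The eight witnesses (one per maximal pattern-free role set) -/

/-- roles ⊆ {AL, T, C, Sq, L232, L232p, L233}: (−14, −15, 3/50, 2802).
[cite: Zhang2022LandauSiegel, §2 (2.18)–(2.19), Props. 2.4–2.5, (2.32)–(2.33)] -/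
def W1 : Thresholds := ⟨-14, -15, 3 / 50, 2802⟩
/-- roles ⊆ {AL, AS, P24, T, C, L232, L232p, L233} (no sign row, no square row): (5, −15, 3/50, 2802).
[cite: Zhang2022LandauSiegel, §2 (2.18)–(2.19), Props. 2.4–2.5, (2.32)–(2.33)] -/
def W2 : Thresholds := ⟨5, -15, 3 / 50, 2802⟩
/-- roles ⊆ {AL, C, Sq, S, L232, L232p, L233}: (−14, 15, 3/50, 2802).
[cite: Zhang2022LandauSiegel, §2 (2.18)–(2.19), Props. 2.4–2.5, (2.32)–(2.33)] -/
def W3 : Thresholds := ⟨-14, 15, 3 / 50, 2802⟩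
/-- roles ⊆ {AL, AS, P24, C, S, L232, L232p, L233}: (5, 15, 3/50, 2802).
[cite: Zhang2022LandauSiegel, §2 (2.18)–(2.19), Props. 2.4–2.5, (2.32)–(2.33)] -/
def W4 : Thresholds := ⟨5, 15, 3 / 50, 2802⟩
/-- roles ⊆ {AL, AS, P24, T, S, L232, L232p, L233}: (5, 2, 3/50, 2802).
[cite: Zhang2022LandauSiegel, §2 (2.18)–(2.19), Props. 2.4–2.5, (2.32)–(2.33)] -/
def W5 : Thresholds := ⟨5, 2, 3 / 50, 2802⟩
/-- roles ⊆ {P24, T, C, Sq, S, L232, L232p, L233} (no cap on thr24): (14, 13, 3/50, 2802).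
[cite: Zhang2022LandauSiegel, §2 (2.18)–(2.19), Props. 2.4–2.5, (2.32)–(2.33)] -/
def W6 : Thresholds := ⟨14, 13, 3 / 50, 2802⟩
/-- every role but L233: (5, 2, 3/50, 65).
[cite: Zhang2022LandauSiegel, §2 (2.18)–(2.19), Props. 2.4–2.5, (2.32)–(2.33)] -/
def W7 : Thresholds := ⟨5, 2, 3 / 50, 65⟩
/-- every role but L232 — the PRINTED design: (5, 2, 0.001, 3000).
[cite: Zhang2022LandauSiegel, §2 (2.18)–(2.19), Props. 2.4–2.5, (2.32)–(2.33)] -/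
def printed : Thresholds := ⟨5, 2, 1 / 1000, 3000⟩

/-- `W1` satisfies every row whose role is not `AS`, `P24`, `S`. [cite: Zhang2022LandauSiegel, §2,
§10 (10.17), §18 (18.2)–(18.3)] -/
theorem wit1 : ∀ r : Row, r.role ≠ .AS → r.role ≠ .P24 → r.role ≠ .S → r.holds W1 := by
  intro r; cases r <;> simp [Row.role, Row.holds, W1, abs_lt] <;> norm_num

/-- `W2` satisfies every row whose role is not `S`, `Sq` (thr25 = −15 < 0: the sign rows are what
exclude it). [cite: Zhang2022LandauSiegel, §2, §10 (10.17), §18 (18.2)–(18.3)] -/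
theorem wit2 : ∀ r : Row, r.role ≠ .S → r.role ≠ .Sq → r.holds W2 := by
  intro r; cases r <;> simp [Row.role, Row.holds, W2, abs_lt] <;> norm_num

/-- `W3` satisfies every row whose role is not `AS`, `P24`, `T`. [cite: Zhang2022LandauSiegel, §2,
§10 (10.17), §18 (18.2)–(18.3)] -/
theorem wit3 : ∀ r : Row, r.role ≠ .AS → r.role ≠ .P24 → r.role ≠ .T → r.holds W3 := by
  intro r; cases r <;> simp [Row.role, Row.holds, W3, abs_lt] <;> norm_num

/-- `W4` satisfies every row whose role is not `T`, `Sq`. [cite: Zhang2022LandauSiegel, §2, §10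
(10.17), §18 (18.2)–(18.3)] -/
theorem wit4 : ∀ r : Row, r.role ≠ .T → r.role ≠ .Sq → r.holds W4 := by
  intro r; cases r <;> simp [Row.role, Row.holds, W4, abs_lt] <;> norm_num

/-- `W5` satisfies every row whose role is not `C`, `Sq`. [cite: Zhang2022LandauSiegel, §2, §10
(10.17), §18 (18.2)–(18.3)] -/
theorem wit5 : ∀ r : Row, r.role ≠ .C → r.role ≠ .Sq → r.holds W5 := by
  intro r; cases r <;> simp [Row.role, Row.holds, W5, abs_lt] <;> norm_num

/-- `W6` satisfies every row whose role is not `AL`, `AS` (thr24 = 14: no cap). [cite: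
Zhang2022LandauSiegel, §2, §10 (10.17), §18 (18.2)–(18.3)] -/
theorem wit6 : ∀ r : Row, r.role ≠ .AL → r.role ≠ .AS → r.holds W6 := by
  intro r; cases r <;> simp [Row.role, Row.holds, W6, abs_lt] <;> norm_num

/-- `W7` satisfies every row whose role is not `L233` (thr233 = 65). [cite: Zhang2022LandauSiegel,
§2, §10 (10.17), §18 (18.2)–(18.3)] -/
theorem wit7 : ∀ r : Row, r.role ≠ .L233 → r.holds W7 := by
  intro r; cases r <;> simp [Row.role, Row.holds, W7, abs_lt] <;> norm_num

/-- The printed design satisfies a terminal row iff the row is not a certified (2.32)-row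
(`N-2.32Gs`, `N-2.32s`, `N-III.18sum`): (2.32) is where the printed constants fail.
[cite: Zhang2022LandauSiegel, §2 (2.18)–(2.19), Props. 2.4–2.5, (2.32)–(2.33)] -/
theorem holds_printed_iff (r : Row) : r.holds printed ↔ r.role ≠ .L232 := by
  cases r <;> simp [Row.role, Row.holds, printed, abs_lt] <;> norm_num

/-! ## Pattern-free role sets are feasible -/

/-- A pattern-free role set is feasible: a decision tree over the roles present ends in one of the
eight maximal pattern-free role sets, each with its witness (`W1`–`W7`, `printed`). [cite:
Zhang2022LandauSiegel, §2 (2.18)–(2.19), Props. 2.4–2.5, (2.32)–(2.33)] -/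
theorem feasible_of_not_hasPattern {S : Finset Row} (h : ¬ HasPattern (roles S)) : Feasible S := by
  have nmem : ∀ {x : Role}, x ∉ roles S → ∀ r ∈ S, r.role ≠ x :=
    fun hx r hr h => hx (Finset.mem_image.mpr ⟨r, hr, h⟩)
  simp only [hasPattern_iff, not_or] at h
  obtain ⟨h1, h2, h3, h4, h5⟩ := h
  by_cases h232 : Role.L232 ∈ roles S
  swap
  · exact ⟨printed, fun r hr => (holds_printed_iff r).mpr (nmem h232 r hr)⟩
  by_cases h233 : Role.L233 ∈ roles S
  swap
  · exact ⟨W7, fun r hr => wit7 r (nmem h233 r hr)⟩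
  by_cases hAL : Role.AL ∈ roles S
  · by_cases hSq : Role.Sq ∈ roles S
    · have hAS : Role.AS ∉ roles S := fun hAS => h3 ⟨hAS, hSq, h232, h233⟩
      have hP24 : Role.P24 ∉ roles S := fun hP => h4 ⟨hAL, hP, hSq, h232, h233⟩
      by_cases hT : Role.T ∈ roles S
      · have hS : Role.S ∉ roles S := fun hS' => h5 ⟨hAL, hT, hS', hSq, h232, h233⟩
        exact ⟨W1, fun r hr => wit1 r (nmem hAS r hr) (nmem hP24 r hr) (nmem hS r hr)⟩
      · exact ⟨W3, fun r hr => wit3 r (nmem hAS r hr) (nmem hP24 r hr) (nmem hT r hr)⟩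
    · by_cases hT : Role.T ∈ roles S
      · by_cases hC : Role.C ∈ roles S
        · have hS : Role.S ∉ roles S := fun hS' => h1 ⟨hAL, hT, hC, hS', h232, h233⟩
          exact ⟨W2, fun r hr => wit2 r (nmem hS r hr) (nmem hSq r hr)⟩
        · exact ⟨W5, fun r hr => wit5 r (nmem hC r hr) (nmem hSq r hr)⟩
      · exact ⟨W4, fun r hr => wit4 r (nmem hT r hr) (nmem hSq r hr)⟩
  · by_cases hAS : Role.AS ∈ roles S
    · have hSq : Role.Sq ∉ roles S := fun hSq => h3 ⟨hAS, hSq, h232, h233⟩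
      by_cases hT : Role.T ∈ roles S
      · by_cases hC : Role.C ∈ roles S
        · have hS : Role.S ∉ roles S := fun hS' => h2 ⟨hAS, hT, hC, hS', h232, h233⟩
          exact ⟨W2, fun r hr => wit2 r (nmem hS r hr) (nmem hSq r hr)⟩
        · exact ⟨W5, fun r hr => wit5 r (nmem hC r hr) (nmem hSq r hr)⟩
      · exact ⟨W4, fun r hr => wit4 r (nmem hT r hr) (nmem hSq r hr)⟩
    · exact ⟨W6, fun r hr => wit6 r (nmem hAL r hr) (nmem hAS r hr)⟩

/-- **Row-level binding cycles.** A set of terminal rows is infeasible over ℝ⁴ iff its roles contain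
one of the five patterns E1–E5.
[cite: Zhang2022LandauSiegel, §2 (2.18)–(2.19), Props. 2.4–2.5, (2.32)–(2.33)] -/
theorem not_feasible_iff_hasPattern (S : Finset Row) : ¬ Feasible S ↔ HasPattern (roles S) :=
  ⟨fun h => by_contra fun h' => h (feasible_of_not_hasPattern h'), not_feasible_of_hasPattern⟩

/-- `Feasible S` iff the roles of `S` contain no pattern. [cite: Zhang2022LandauSiegel, §2
(2.18)–(2.19), Props. 2.4–2.5, (2.32)–(2.33)] -/
theorem feasible_iff_not_hasPattern (S : Finset Row) : Feasible S ↔ ¬ HasPattern (roles S) := by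
  rw [← not_feasible_iff_hasPattern, not_not]

/-! ## Consequences -/

/-- Every pattern contains `L232` and `L233` and avoids `L232p`. [folklore] -/
theorem patterns_mem : ∀ e ∈ patterns, Role.L232 ∈ e ∧ Role.L233 ∈ e ∧ Role.L232p ∉ e := by
  simp [patterns, E1, E2, E3, E4, E5]

/-- Every infeasible subsystem of the terminal block contains a certified (2.32)-row and a
(2.33)-row: the binding cycles all pass through (2.32) AND (2.33).
[cite: Zhang2022LandauSiegel, §2 (2.18)–(2.19), Props. 2.4–2.5, (2.32)–(2.33)] -/
theorem mem_roles_of_not_feasible {S : Finset Row} (h : ¬ Feasible S) :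
    Role.L232 ∈ roles S ∧ Role.L233 ∈ roles S := by
  obtain ⟨e, he, hsub⟩ := (not_feasible_iff_hasPattern S).mp h
  obtain ⟨h1, h2, -⟩ := patterns_mem e he
  exact ⟨hsub h1, hsub h2⟩

/-- In particular a system without a certified (2.32)-row is feasible (the printed design is a
witness), and so is one without a (2.33)-row.
[cite: Zhang2022LandauSiegel, §2 (2.18)–(2.19), Props. 2.4–2.5, (2.32)–(2.33)] -/
theorem feasible_of_L232_not_mem {S : Finset Row} (h : Role.L232 ∉ roles S) : Feasible S := by
  by_contra h'
  exact h (mem_roles_of_not_feasible h').1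

/-- A system without a (2.33)-row (role `L233`) is feasible. [cite: Zhang2022LandauSiegel, §2
(2.18)–(2.19), Props. 2.4–2.5, (2.32)–(2.33)] -/
theorem feasible_of_L233_not_mem {S : Finset Row} (h : Role.L233 ∉ roles S) : Feasible S := by
  by_contra h'
  exact h (mem_roles_of_not_feasible h').2

/-- `III-18.02b` — the manuscript's own value 0.0008 of (18.2), whose premise (8.24) fails
(`not_ineq824`, module `Section8Certificate`) — lies in NO binding cycle: erasing it never restores
feasibility. [cite: Zhang2022LandauSiegel, §2, §10 (10.17), §18 (18.2)–(18.3)] -/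
theorem not_feasible_erase_iff (S : Finset Row) :
    ¬ Feasible (S.erase .III_18_02b) ↔ ¬ Feasible S := by
  constructor
  · exact fun h hS => h (feasible_mono (Finset.erase_subset _ _) hS)
  · intro h
    obtain ⟨e, he, hsub⟩ := (not_feasible_iff_hasPattern S).mp h
    obtain ⟨-, -, h3⟩ := patterns_mem e he
    refine (not_feasible_iff_hasPattern _).mpr ⟨e, he, fun x hx => ?_⟩
    obtain ⟨r, hr, hrx⟩ := Finset.mem_image.mp (hsub hx)
    refine Finset.mem_image.mpr ⟨r, Finset.mem_erase.mpr ⟨?_, hr⟩, hrx⟩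
    rintro rfl
    simp only [Row.role] at hrx
    subst hrx
    exact h3 hx

/-- The whole terminal block (all 19 rows) is infeasible.
[cite: Zhang2022LandauSiegel, §2 (2.18)–(2.19), Props. 2.4–2.5, (2.32)–(2.33)] -/
theorem not_feasible_univ : ¬ Feasible (Finset.univ : Finset Row) := by
  refine not_feasible_of_hasPattern ⟨E3, by simp [patterns], fun x _ => ?_⟩
  exact Finset.mem_image.mpr (by
    rcases x with _ | _ | _ | _ | _ | _ | _ | _ | _ | _
    · exact ⟨.N_II_10_17a, Finset.mem_univ _, rfl⟩
    · exact ⟨.N_P2_4n, Finset.mem_univ _, rfl⟩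
    · exact ⟨.I_P2_4a, Finset.mem_univ _, rfl⟩
    · exact ⟨.I_T9a, Finset.mem_univ _, rfl⟩
    · exact ⟨.I_2_32a, Finset.mem_univ _, rfl⟩
    · exact ⟨.I_P2_5a, Finset.mem_univ _, rfl⟩
    · exact ⟨.N_P2_5s, Finset.mem_univ _, rfl⟩
    · exact ⟨.N_2_32Gs, Finset.mem_univ _, rfl⟩
    · exact ⟨.III_18_02b, Finset.mem_univ _, rfl⟩
    · exact ⟨.III_18_03f, Finset.mem_univ _, rfl⟩)

/-- The sign of thr25 is load-bearing in the linear typing: all rows except the two sign rows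
(`I-P2.5a`, `III-2.P25b`) and the square row `N-P2.5s` hold together at `W2 = (5, −15, 3/50, 2802)`
(the kernel face of the cell's typing note S1-R7 (a) / S2-10 (i)).
[cite: Zhang2022LandauSiegel, §2 (2.18)–(2.19), Props. 2.4–2.5, (2.32)–(2.33)] -/
theorem sat_W2 : Sat (Finset.univ.filter fun r => r.role ≠ .S ∧ r.role ≠ .Sq) W2 := by
  intro r hr
  simp only [Finset.mem_filter, Finset.mem_univ, true_and] at hr
  exact wit2 r hr.1 hr.2

/-! ## Minimal infeasible subsystems = transversals of a pattern -/

/-- `IsMinimalIIS S`: `S` is infeasible and every proper (drop-one) subsystem is feasible.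
[folklore] -/
def IsMinimalIIS (S : Finset Row) : Prop := ¬ Feasible S ∧ ∀ r ∈ S, Feasible (S.erase r)

/-- The patterns form an antichain closed under nothing: dropping any role from a pattern leaves a
pattern-free set. [folklore] -/
theorem not_hasPattern_erase : ∀ e ∈ patterns, ∀ x ∈ e, ¬ HasPattern (e.erase x) := by
  simp [patterns, E1, E2, E3, E4, E5, hasPattern_iff, Finset.mem_erase]

/-- **The minimal IIS are exactly the transversals**: `S` is a minimal infeasible subsystem iff its
role set IS one of the five patterns and `S` has exactly one row per role.
[cite: Zhang2022LandauSiegel, §2 (2.18)–(2.19), Props. 2.4–2.5, (2.32)–(2.33)] -/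
theorem isMinimalIIS_iff (S : Finset Row) :
    IsMinimalIIS S ↔ ∃ e ∈ patterns, roles S = e ∧ S.card = e.card := by
  constructor
  · rintro ⟨hinf, hmin⟩
    obtain ⟨e, he, hsub⟩ := (not_feasible_iff_hasPattern S).mp hinf
    -- no role outside the pattern
    have hsup : roles S ⊆ e := by
      intro x hx
      by_contra hxe
      obtain ⟨r, hr, hrx⟩ := Finset.mem_image.mp hx
      refine (not_feasible_iff_hasPattern _).mpr ⟨e, he, fun y hy => ?_⟩ (hmin r hr)
      obtain ⟨r', hr', hr'y⟩ := Finset.mem_image.mp (hsub hy)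
      refine Finset.mem_image.mpr ⟨r', Finset.mem_erase.mpr ⟨?_, hr'⟩, hr'y⟩
      rintro rfl
      exact hxe (hrx ▸ hr'y ▸ hy)
    have heq : roles S = e := Finset.Subset.antisymm hsup hsub
    -- one row per role
    have hinj : Set.InjOn Row.role S := by
      intro r hr r' hr' hrr'
      by_contra hne
      refine (not_feasible_iff_hasPattern _).mpr ⟨e, he, fun y hy => ?_⟩ (hmin r hr)
      obtain ⟨r'', hr'', hr''y⟩ := Finset.mem_image.mp (hsub hy)
      by_cases h'' : r'' = r
      · subst h''
        exact Finset.mem_image.mpr ⟨r', Finset.mem_erase.mpr ⟨fun h => hne h.symm, hr'⟩,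
          hrr' ▸ hr''y⟩
      · exact Finset.mem_image.mpr ⟨r'', Finset.mem_erase.mpr ⟨h'', hr''⟩, hr''y⟩
    refine ⟨e, he, heq, ?_⟩
    rw [← heq, roles, Finset.card_image_of_injOn hinj]
  · rintro ⟨e, he, heq, hcard⟩
    refine ⟨(not_feasible_iff_hasPattern S).mpr ⟨e, he, heq ▸ subset_rfl⟩, fun r hr => ?_⟩
    have hinj : Set.InjOn Row.role S := by
      rw [← Finset.card_image_iff]
      change (roles S).card = S.card
      rw [heq, hcard]
    have hrole : r.role ∈ e := heq ▸ Finset.mem_image.mpr ⟨r, hr, rfl⟩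
    refine feasible_of_not_hasPattern fun hp => not_hasPattern_erase e he r.role hrole ?_
    refine hasPattern_mono (fun y hy => ?_) hp
    obtain ⟨r', hr', hr'y⟩ := Finset.mem_image.mp hy
    obtain ⟨hne, hr'S⟩ := Finset.mem_erase.mp hr'
    refine Finset.mem_erase.mpr ⟨?_, heq ▸ Finset.mem_image.mpr ⟨r', hr'S, hr'y⟩⟩
    rintro rfl
    exact hne (hinj hr'S hr hr'y)

/-! ## Counting: the 372 minimal infeasible subsystems -/

/-- The rows of a given role. [folklore] -/
def fibre (x : Role) : Finset Row := Finset.univ.filter fun r => r.role = x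

/-- Membership in a fibre is having that role. [folklore] -/
@[simp] theorem mem_fibre {x : Role} {r : Row} : r ∈ fibre x ↔ r.role = x := by simp [fibre]

/-- Number of terminal rows of each role.
[cite: Zhang2022LandauSiegel, §2, §10 (10.17), §18 (18.2)–(18.3)] -/
def mult (x : Role) : ℕ := (fibre x).card

/-- Fibre sizes of the terminal block: AL 1, AS 2, P24 1, T 2, C 2, S 2, Sq 1, L232 3, L232p 1, L233
4 (19 rows). [cite: Zhang2022LandauSiegel, §2, §10 (10.17), §18 (18.2)–(18.3)] -/
theorem mult_eq : mult .AL = 1 ∧ mult .AS = 2 ∧ mult .P24 = 1 ∧ mult .T = 2 ∧ mult .C = 2 ∧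
    mult .S = 2 ∧ mult .Sq = 1 ∧ mult .L232 = 3 ∧ mult .L232p = 1 ∧ mult .L233 = 4 := by
  decide

/-- The set of rows selected by a section `f` of the role map over `e`. [folklore] -/
def sectionImage (e : Finset Role) (f : (x : Role) → x ∈ e → Row) : Finset Row :=
  e.attach.image fun x => f x.1 x.2

/-- The transversals of `e`: one row of each role in `e`. [folklore] -/
def transversals (e : Finset Role) : Finset (Finset Row) :=
  (e.pi fun x => fibre x).image (sectionImage e)

/-- A section of the role map picks, over `x`, a row of role `x`. [folklore] -/
theorem role_apply_of_mem_pi {e : Finset Role} {f : (x : Role) → x ∈ e → Row}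
    (hf : f ∈ e.pi fun x => fibre x) (x : Role) (hx : x ∈ e) : (f x hx).role = x :=
  mem_fibre.mp (Finset.mem_pi.mp hf x hx)

/-- The rows selected by a section over `e` have role set `e`. [folklore] -/
theorem roles_sectionImage {e : Finset Role} {f : (x : Role) → x ∈ e → Row}
    (hf : f ∈ e.pi fun x => fibre x) : roles (sectionImage e f) = e := by
  ext y
  simp only [roles, sectionImage, Finset.mem_image, Finset.mem_attach, true_and, Subtype.exists]
  constructor
  · rintro ⟨r, ⟨x, hx, rfl⟩, rfl⟩
    rwa [role_apply_of_mem_pi hf x hx]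
  · intro hy
    exact ⟨f y hy, ⟨y, hy, rfl⟩, role_apply_of_mem_pi hf y hy⟩

/-- A section over `e` selects `e.card` rows (sections are injective: the role is recovered).
[folklore] -/
theorem card_sectionImage {e : Finset Role} {f : (x : Role) → x ∈ e → Row}
    (hf : f ∈ e.pi fun x => fibre x) : (sectionImage e f).card = e.card := by
  rw [sectionImage, Finset.card_image_of_injective _ ?_, Finset.card_attach]
  rintro ⟨x, hx⟩ ⟨y, hy⟩ h
  have := congrArg Row.role h
  simp only [role_apply_of_mem_pi hf] at this
  exact Subtype.ext this

/-- `S` is a transversal of `e` iff its role set is `e` and it has one row per role. [folklore] -/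
theorem mem_transversals_iff {e : Finset Role} {S : Finset Row} :
    S ∈ transversals e ↔ roles S = e ∧ S.card = e.card := by
  constructor
  · intro h
    obtain ⟨f, hf, rfl⟩ := Finset.mem_image.mp h
    exact ⟨roles_sectionImage hf, card_sectionImage hf⟩
  · rintro ⟨hroles, hcard⟩
    have hinj : Set.InjOn Row.role S := by
      rw [← Finset.card_image_iff]
      change (roles S).card = S.card
      rw [hroles, hcard]
    have hex : ∀ x ∈ e, ∃ r ∈ S, r.role = x := fun x hx => by
      have hx' : x ∈ roles S := hroles.symm ▸ hx
      exact Finset.mem_image.mp hx'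
    choose f hfS hfrole using hex
    refine Finset.mem_image.mpr ⟨f, Finset.mem_pi.mpr fun x hx => mem_fibre.mpr (hfrole x hx), ?_⟩
    ext r
    simp only [sectionImage, Finset.mem_image, Finset.mem_attach, true_and, Subtype.exists]
    constructor
    · rintro ⟨x, hx, rfl⟩
      exact hfS x hx
    · intro hr
      have hx : r.role ∈ e := hroles ▸ Finset.mem_image.mpr ⟨r, hr, rfl⟩
      exact ⟨r.role, hx, hinj (hfS _ hx) hr (hfrole _ hx)⟩

/-- Product rule: the number of transversals of `e` is the product of the fibre sizes. [folklore] -/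
theorem card_transversals_eq (e : Finset Role) : (transversals e).card = ∏ x ∈ e, mult x := by
  rw [transversals, Finset.card_image_of_injOn ?_, Finset.card_pi]
  · rfl
  intro f hf g hg hfg
  funext x hx
  have hmem : f x hx ∈ sectionImage e g := by
    rw [← hfg]
    exact Finset.mem_image.mpr ⟨⟨x, hx⟩, Finset.mem_attach _ _, rfl⟩
  obtain ⟨⟨y, hy⟩, -, hgy⟩ := Finset.mem_image.mp hmem
  have hyx : y = x := by
    have := congrArg Row.role hgy
    rwa [role_apply_of_mem_pi (Finset.mem_coe.mp hg), role_apply_of_mem_pi (Finset.mem_coe.mp hf)]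
      at this
  subst hyx
  exact hgy.symm

/-- The minimal infeasible subsystems are the transversals of the patterns.
[cite: Zhang2022LandauSiegel, §2 (2.18)–(2.19), Props. 2.4–2.5, (2.32)–(2.33)] -/
theorem isMinimalIIS_iff_mem_transversals (S : Finset Row) :
    IsMinimalIIS S ↔ ∃ e ∈ patterns, S ∈ transversals e := by
  simp only [isMinimalIIS_iff, mem_transversals_iff]

/-- The patterns as a `Finset`.
[cite: Zhang2022LandauSiegel, §2 (2.18)–(2.19), Props. 2.4–2.5, (2.32)–(2.33)] -/
def patternSet : Finset (Finset Role) := {E1, E2, E3, E4, E5}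

/-- `patternSet` and the list `patterns` have the same members. [folklore] -/
theorem mem_patternSet {e : Finset Role} : e ∈ patternSet ↔ e ∈ patterns := by
  simp [patternSet, patterns]

/-- The catalogue of minimal infeasible subsystems of the terminal block.
[cite: Zhang2022LandauSiegel, §2 (2.18)–(2.19), Props. 2.4–2.5, (2.32)–(2.33)] -/
def minimalIISs : Finset (Finset Row) := patternSet.biUnion transversals

/-- `minimalIISs` is exactly the set of minimal infeasible subsystems.
[cite: Zhang2022LandauSiegel, §2 (2.18)–(2.19), Props. 2.4–2.5, (2.32)–(2.33)] -/
theorem mem_minimalIISs_iff (S : Finset Row) : S ∈ minimalIISs ↔ IsMinimalIIS S := by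
  rw [isMinimalIIS_iff_mem_transversals, minimalIISs, Finset.mem_biUnion]
  simp only [mem_patternSet]

/-- The five patterns are pairwise distinct. [folklore] -/
theorem patterns_nodup : patterns.Nodup := by
  decide

/-- **372 binding cycles.** The terminal block has exactly
1·2·2·2·3·4 + 2·2·2·2·3·4 + 2·1·3·4 + 1·1·1·3·4 + 1·2·2·1·3·4 = 96 + 192 + 24 + 12 + 48 = 372
minimal infeasible subsystems — the count the cell's exact-rational enumeration reports (sweep-2
gen 5, `binding_map_v7_out.json`: M1 288, M2 24, M3 12, M3′ 48; farm replay j057717).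
[cite: Zhang2022LandauSiegel, §2 (2.18)–(2.19), Props. 2.4–2.5, (2.32)–(2.33)] -/
theorem card_minimalIISs : minimalIISs.card = 372 := by
  have hdisj : ∀ e ∈ patternSet, ∀ e' ∈ patternSet, e ≠ e' →
      Disjoint (transversals e) (transversals e') := by
    intro e _ e' _ hne
    rw [Finset.disjoint_left]
    intro S hS hS'
    exact hne ((mem_transversals_iff.mp hS).1.symm.trans (mem_transversals_iff.mp hS').1)
  rw [minimalIISs, Finset.card_biUnion hdisj]
  have hset : patternSet = patterns.toFinset := by
    ext e; rw [mem_patternSet, List.mem_toFinset]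
  rw [hset, List.sum_toFinset _ patterns_nodup]
  simp only [card_transversals_eq]
  decide

/-- By mechanism: M1 (E1 ∪ E2) 96 + 192 = 288, M2 (E3) 24, M3 (E4) 12, M3′ (E5) 48 — the cell's
per-mechanism counts.
[cite: Zhang2022LandauSiegel, §2 (2.18)–(2.19), Props. 2.4–2.5, (2.32)–(2.33)] -/
theorem card_transversals_by_mechanism :
    (transversals E1).card + (transversals E2).card = 288 ∧ (transversals E3).card = 24 ∧
    (transversals E4).card = 12 ∧ (transversals E5).card = 48 := by
  simp only [card_transversals_eq]
  decide

/-- Every minimal infeasible subsystem has 4, 5 or 6 rows (E3: 4; E4: 5; E1, E2, E5: 6) — the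
cell's size profile 24 / 12 / 336, none larger.
[cite: Zhang2022LandauSiegel, §2 (2.18)–(2.19), Props. 2.4–2.5, (2.32)–(2.33)] -/
theorem card_of_isMinimalIIS {S : Finset Row} (h : IsMinimalIIS S) :
    S.card = 4 ∨ S.card = 5 ∨ S.card = 6 := by
  obtain ⟨e, he, -, hcard⟩ := (isMinimalIIS_iff S).mp h
  rw [hcard]
  simp only [patterns, List.mem_cons, List.not_mem_nil, or_false] at he
  rcases he with rfl | rfl | rfl | rfl | rfl <;> decide

end TerminalBlock

end Literature.NumberTheory.LFunctions.Zhang2022
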